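import Summits.AtomisticToContinuum.Crystallization.Theses.IsometryAtoms

/-!
# Non-vacuity of the frame of `AtomicLawChargesCrystal` (stmt-AtomisticToContinuum-15778)

The four hypotheses of the bridge `IsometryAtoms.AtomicLawChargesCrystal` — probability law,
a.s. `δ`-hard-core, point-stationary (Mecke identity), a.s. relatively dense, atom modulo isometry —
are jointly satisfiable by a NON-degenerate law: the deterministic rooted cubic lattice
`δ_{count|ℤ³}` (`δ = 1`, `R₀ = 1`, atom `Y = ℤ³`).  Refuter evidence (vacuity check 3b of the
crux attack): the crux is not true for lack of instances.  Reusable by provers of the crux: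
`measurableSet_setOf_eq_count_restrict` (for every COUNTABLE `D`, `{count|D}` is Giry-measurable —
the tree had the `Finset` case, `MinimiserShells.Negative.LoadBearing`), the self-invariance lemmas
`map_sub_latticeConfig` / `map_neg_latticeConfig` and `isPointStationaryLaw_dirac_latticeConfig`.
Supports item stmt-AtomisticToContinuum-15778 (companion of `Negative.FalseWithoutRelDense`).
-/

noncomputable section

open MeasureTheory
open scoped ENNReal

namespace Summit.AtomisticToContinuum.Crystallization.Theorems.AtomicLawChargesCrystal.Negative.LatticeLaw

open Literature.Probability.Process
open Literature.MathematicalPhysics.StatisticalMechanics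

local notation "E3" => EuclideanSpace ℝ (Fin 3)

/-- The embedding of integer vectors. -/
def zVec (n : Fin 3 → ℤ) : E3 := WithLp.toLp 2 fun i => (n i : ℝ)

/-- Coordinates of an integer vector. -/
@[simp] theorem zVec_apply (n : Fin 3 → ℤ) (i : Fin 3) : zVec n i = (n i : ℝ) := rfl

/-- `zVec` is additive: differences. -/
theorem zVec_sub (n m : Fin 3 → ℤ) : zVec n - zVec m = zVec (n - m) := by
  ext i; simp [zVec]

/-- `zVec` is additive: negation. -/
theorem zVec_neg (n : Fin 3 → ℤ) : -zVec n = zVec (-n) := by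
  ext i; simp [zVec]

/-- `zVec 0 = 0`. -/
theorem zVec_zero : zVec 0 = 0 := by
  ext i; simp [zVec]

/-- The cubic lattice `ℤ³ ⊂ ℝ³`. -/
def zCube : Set E3 := Set.range zVec

/-- `ℤ³` is countable. -/
theorem zCube_countable : zCube.Countable := Set.countable_range _

/-- `ℤ³` is measurable. -/
theorem zCube_measurableSet : MeasurableSet zCube := zCube_countable.measurableSet

/-- `0 ∈ ℤ³`. -/
theorem zero_mem_zCube : (0 : E3) ∈ zCube := ⟨0, zVec_zero⟩

/-- `ℤ³` is closed under subtraction. -/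
theorem sub_mem_zCube {v w : E3} (hv : v ∈ zCube) (hw : w ∈ zCube) : v - w ∈ zCube := by
  obtain ⟨n, rfl⟩ := hv; obtain ⟨m, rfl⟩ := hw
  exact ⟨n - m, (zVec_sub n m).symm⟩

/-- `ℤ³` is closed under negation. -/
theorem neg_mem_zCube {v : E3} (hv : v ∈ zCube) : -v ∈ zCube := by
  obtain ⟨n, rfl⟩ := hv
  exact ⟨-n, (zVec_neg n).symm⟩

/-- A non-zero integer vector has norm `≥ 1`. -/
theorem one_le_norm_of_mem_zCube {v : E3} (hv : v ∈ zCube) (h0 : v ≠ 0) : 1 ≤ ‖v‖ := by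
  obtain ⟨n, rfl⟩ := hv
  have hn : n ≠ 0 := by
    rintro rfl
    exact h0 zVec_zero
  obtain ⟨i, hi⟩ : ∃ i, n i ≠ 0 := by
    by_contra! h
    exact hn (funext h)
  have h1 : (1 : ℝ) ≤ |(n i : ℝ)| := by
    rw [← Int.cast_abs]
    exact_mod_cast Int.one_le_abs hi
  calc (1 : ℝ) ≤ |(n i : ℝ)| := h1
    _ = ‖zVec n i‖ := by rw [zVec_apply, Real.norm_eq_abs]
    _ ≤ ‖zVec n‖ := PiLp.norm_apply_le (zVec n) i

/-- `ℤ³` is `1`-separated. -/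
theorem zCube_separated : ∀ x ∈ zCube, ∀ y ∈ zCube, x ≠ y → (1 : ℝ) ≤ dist x y := by
  intro x hx y hy hxy
  rw [dist_eq_norm]
  exact one_le_norm_of_mem_zCube (sub_mem_zCube hx hy) (sub_ne_zero.2 hxy)

/-- `ℤ³` is relatively dense with covering radius `≤ 1` (round the coordinates). -/
theorem zCube_relDense (z : E3) : ∃ y ∈ zCube, dist z y ≤ 1 := by
  refine ⟨zVec fun i => round (z i), ⟨_, rfl⟩, ?_⟩
  rw [EuclideanSpace.dist_eq]
  have hterm : ∀ i, dist (z i) (zVec (fun i => round (z i)) i) ^ 2 ≤ 1 / 4 := by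
    intro i
    rw [zVec_apply, Real.dist_eq]
    have h := abs_sub_round (z i)
    have h0 := abs_nonneg (z i - round (z i))
    nlinarith
  have hsum : ∑ i, dist (z i) (zVec (fun i => round (z i)) i) ^ 2 ≤ 1 := by
    calc ∑ i, dist (z i) (zVec (fun i => round (z i)) i) ^ 2 ≤ ∑ _i : Fin 3, (1 / 4 : ℝ) :=
          Finset.sum_le_sum fun i _ => hterm i
      _ ≤ 1 := by simp; norm_num
  calc Real.sqrt (∑ i, dist (z i) (zVec (fun i => round (z i)) i) ^ 2) ≤ Real.sqrt 1 :=
        Real.sqrt_le_sqrt hsum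
    _ = 1 := Real.sqrt_one

/-- The rooted lattice configuration `count|ℤ³`. -/
def latticeConfig : Measure E3 := (Measure.count : Measure E3).restrict zCube

/-- For a countable set `D`, `{count|D}` is Giry-measurable (cut out by countably many evaluations).
[folklore] -/
theorem measurableSet_setOf_eq_count_restrict {D : Set E3} (hD : D.Countable) :
    MeasurableSet {μ : Measure E3 | μ = (Measure.count : Measure E3).restrict D} := by
  have hDm : MeasurableSet D := hD.measurableSet
  have key : ∀ ν : Measure E3, (∀ s ∈ D, ν {s} = 1) → ∀ A : Set E3,
      ν (A ∩ D) = ∑' _p : ↥(A ∩ D), (1 : ℝ≥0∞) := by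
    intro ν hν A
    have h := measure_biUnion (μ := ν) (s := A ∩ D) (f := fun x : E3 => ({x} : Set E3))
      (hD.mono Set.inter_subset_right) (fun x _ y _ hxy => Set.disjoint_singleton.2 hxy)
      (fun b _ => measurableSet_singleton b)
    rw [Set.biUnion_of_singleton] at h
    rw [h]
    exact tsum_congr fun p => hν p p.2.2
  have hrepr : {μ : Measure E3 | μ = (Measure.count : Measure E3).restrict D} =
      {μ : Measure E3 | μ Dᶜ = 0} ∩ ⋂ s ∈ D, {μ : Measure E3 | μ {s} = 1} := by
    ext μ
    simp only [Set.mem_setOf_eq, Set.mem_inter_iff, Set.mem_iInter]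
    constructor
    · rintro rfl
      refine ⟨?_, fun s hs => ?_⟩
      · rw [Measure.restrict_apply hDm.compl, Set.compl_inter_self, measure_empty]
      · rw [Measure.restrict_apply (measurableSet_singleton s),
          Set.inter_eq_left.2 (Set.singleton_subset_iff.2 hs), Measure.count_singleton]
    · rintro ⟨hc, h1⟩
      ext A hA
      rw [Measure.restrict_apply hA]
      have hdiff : μ (A \ D) = 0 := measure_mono_null (fun x hx => hx.2) hc
      rw [← measure_inter_add_sdiff A hDm, hdiff, add_zero, key μ h1 A,
        key Measure.count (fun s _ => Measure.count_singleton s) A]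
  rw [hrepr]
  refine MeasurableSet.inter ?_ (MeasurableSet.biInter hD fun s _ => ?_)
  · exact (Measure.measurable_coe hDm.compl) (measurableSet_singleton 0)
  · exact (Measure.measurable_coe (measurableSet_singleton s)) (measurableSet_singleton 1)

/-- `{count|ℤ³}` is Giry-measurable. -/
theorem measurableSet_eq_latticeConfig : MeasurableSet {μ : Measure E3 | μ = latticeConfig} :=
  measurableSet_setOf_eq_count_restrict zCube_countable

/-- Under `δ_{count|ℤ³}` almost every configuration IS `count|ℤ³`. -/
theorem ae_eq_latticeConfig :
    ∀ᵐ μ ∂(Measure.dirac latticeConfig : Measure (Measure E3)), μ = latticeConfig := by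
  rw [ae_iff]
  have h : {μ : Measure E3 | ¬μ = latticeConfig} = {μ : Measure E3 | μ = latticeConfig}ᶜ := rfl
  rw [h, Measure.dirac_apply' _ measurableSet_eq_latticeConfig.compl]
  simp

/-- The points of `count|ℤ³` are exactly `ℤ³`. -/
theorem latticeConfig_singleton_ne_zero_iff (y : E3) : latticeConfig {y} ≠ 0 ↔ y ∈ zCube :=
  count_restrict_singleton_ne_zero_iff zCube y

/-- `count|ℤ³` is a rooted `1`-hard-core configuration. -/
theorem isRootedHardCore_latticeConfig : IsRootedHardCore 1 latticeConfig :=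
  ⟨zCube, zero_mem_zCube, zCube_separated, rfl⟩

/-- `count|ℤ³` is invariant under the shift by each of its points. -/
theorem map_sub_latticeConfig {y : E3} (hy : y ∈ zCube) :
    latticeConfig.map (fun z => z - y) = latticeConfig := by
  unfold latticeConfig
  rw [map_sub_count_restrict]
  congr 1
  ext v
  constructor
  · rintro ⟨w, hw, rfl⟩
    exact sub_mem_zCube hw hy
  · intro hv
    exact ⟨v + y, by simpa using sub_mem_zCube hv (neg_mem_zCube hy), add_sub_cancel_right v y⟩

/-- `count|ℤ³` is invariant under `y ↦ -y`. -/
theorem map_neg_latticeConfig : latticeConfig.map (fun y : E3 => -y) = latticeConfig := by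
  unfold latticeConfig
  ext s hs
  rw [Measure.map_apply measurable_neg hs, Measure.restrict_apply (measurable_neg hs),
    Measure.restrict_apply hs]
  have hpre : (fun y : E3 => -y) ⁻¹' s ∩ zCube = Neg.neg '' (s ∩ zCube) := by
    ext v
    simp only [Set.mem_inter_iff, Set.mem_preimage, Set.mem_image]
    constructor
    · rintro ⟨hv, hvz⟩
      exact ⟨-v, ⟨hv, neg_mem_zCube hvz⟩, neg_neg v⟩
    · rintro ⟨w, ⟨hw, hwz⟩, rfl⟩
      exact ⟨by simpa using hw, neg_mem_zCube hwz⟩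
  rw [hpre, Measure.count_injective_image neg_injective]

/-- The law `δ_{count|ℤ³}` is point-stationary. -/
theorem isPointStationaryLaw_dirac_latticeConfig :
    IsPointStationaryLaw (Measure.dirac latticeConfig : Measure (Measure E3)) := by
  refine IsPointStationaryLaw.of_ae_invariant (ae_eq_latticeConfig.mono fun μ hμ => ?_)
  subst hμ
  refine ⟨?_, map_neg_latticeConfig⟩
  unfold latticeConfig
  rw [ae_restrict_iff' zCube_measurableSet]
  exact Filter.Eventually.of_forall fun y hy => map_sub_latticeConfig hy

/-- **The frame of `AtomicLawChargesCrystal` is inhabited by a genuine crystal law**: `δ_{count|ℤ³}`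
is a probability law, a.s. `1`-hard-core, point-stationary, a.s. relatively dense (`R₀ = 1`), and
charges (with mass `1`) the rooted isometry class of `Y = ℤ³`. [folklore] -/
theorem frame_inhabited :
    ∃ P : Measure (Measure E3), IsProbabilityMeasure P ∧
      (∀ᵐ μ ∂P, IsRootedHardCore 1 μ) ∧ IsPointStationaryLaw P ∧
      (∀ᵐ μ ∂P, ∃ R₀ : ℝ, ∀ z : E3, ∃ y : E3, μ {y} ≠ 0 ∧ dist z y ≤ R₀) ∧
      ∃ Y : Set E3, 0 < P {μ | ∃ A : E3 →ₗᵢ[ℝ] E3, ∃ q ∈ Y,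
        μ = (Measure.count : Measure E3).restrict ((fun s => A (s - q)) '' Y)} := by
  refine ⟨Measure.dirac latticeConfig, inferInstance,
    ae_eq_latticeConfig.mono fun μ hμ => hμ ▸ isRootedHardCore_latticeConfig,
    isPointStationaryLaw_dirac_latticeConfig,
    ae_eq_latticeConfig.mono fun μ hμ => ?_, zCube, ?_⟩
  · subst hμ
    refine ⟨1, fun z => ?_⟩
    obtain ⟨y, hy, hd⟩ := zCube_relDense z
    exact ⟨y, (latticeConfig_singleton_ne_zero_iff y).2 hy, hd⟩
  · have hmem : latticeConfig ∈ {μ : Measure E3 | ∃ A : E3 →ₗᵢ[ℝ] E3, ∃ q ∈ zCube,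
        μ = (Measure.count : Measure E3).restrict ((fun s => A (s - q)) '' zCube)} := by
      refine ⟨LinearIsometry.id, 0, zero_mem_zCube, ?_⟩
      unfold latticeConfig
      congr 1
      ext v
      simp
    have hind : Set.indicator {μ : Measure E3 | ∃ A : E3 →ₗᵢ[ℝ] E3, ∃ q ∈ zCube,
        μ = (Measure.count : Measure E3).restrict ((fun s => A (s - q)) '' zCube)}
        (1 : Measure E3 → ℝ≥0∞) latticeConfig = 1 := by
      rw [Set.indicator_of_mem hmem, Pi.one_apply]
    calc (0 : ℝ≥0∞) < 1 := one_pos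
      _ = _ := hind.symm
      _ ≤ _ := Measure.le_dirac_apply

end Summit.AtomisticToContinuum.Crystallization.Theorems.AtomicLawChargesCrystal.Negative.LatticeLaw
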